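import Mathlib.Topology.Algebra.InfiniteSum.Basic
import Mathlib.Topology.Algebra.InfiniteSum.Real
import Mathlib.Data.Nat.Factorial.Basic
import Mathlib.MeasureTheory.Measure.Dirac
import Mathlib.MeasureTheory.Measure.Typeclasses.Probability
import Mathlib.Combinatorics.SimpleGraph.Finite
import Mathlib.Order.SymmDiff
import Literature.Probability.LatticeModels.LatticeGraph
import Literature.Probability.LatticeModels.Correlations
import Literature.Probability.LatticeModels.IsingModel
import Literature.Probability.Percolation.Percolation
import HarnessLib

-- provenance: harness21/H21/H21/Prelude/StatMech/RandomCurrents.lean @ 83d3230 (interim HEAD d8f2665); M5 mechanical rewrite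
/-!
# The random-current representation of the Ising model

Trunk G02 (T-STATMECH), prelude item P21 `RandomCurrents` (notion
`random_current_representation`).

For a finite simple graph `G` on `V` a *current* is a function `n : E(G) → ℕ`. Its set of
*sources* `∂n` is the set of vertices of odd `n`-degree, its weight at inverse temperature `β` is
`w_β(n) = ∏_e β^{n_e} / n_e!`. Expanding `exp (β σ_x σ_y)` edge by edge in the free-boundary,
zero-field Ising partition function gives (Griffiths–Hurst–Sherman 1970; Aizenman 1982;
Duminil-Copin, *Random currents expansion of the Ising model*, arXiv:1607.06933, §2, eq. (2.2))

* `Z^∅_{G;β,0} = 2^{|V|} ∑_{∂n = ∅} w_β(n)` (`isingPartitionFunction_free_eq`),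
* `⟨σ_A⟩^∅_{G;β,0} = (∑_{∂n = A} w_β(n)) / (∑_{∂n = ∅} w_β(n))` (`isingCorr_free_eq_currentSum_div`,
  `isingTwoPoint_free_eq_currentSum_div`),

and the *switching lemma* (`currentSum_switching`, Duminil-Copin 2016, Lemma 2.2) for pairs of
currents, whose probabilistic reading uses the *double-current measure*
`doubleCurrentMeasure G β A B` and the trace `n.traced : BondConfig V` of a current.

## Design

* Context: `[Fintype V] [DecidableEq V] (G : SimpleGraph V) [DecidableRel G.Adj]`, so that
  `G.edgeFinset` is available; `Current G := G.edgeFinset → ℕ` (an `abbrev`, so it inherits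
  addition, `0`, the product measurable space of `ℕ` — every set is measurable — and countability).
* `currentSum G β A = ∑' n, 1{∂n = A} w_β(n)` is a `tsum` over the countably infinite type of
  currents; summability (`summable_currentWeight_indicator`) is by comparison with
  `∏_e exp β = exp (β |E|)`.
* `doubleCurrentMeasure` is an explicit normalised `Measure.sum` of Dirac masses (outline §0/D3':
  the weights `β^{n}/n!` are not of the form `exp (f n)` at `β = 0`, so `Measure.tilted` is not
  used). If no current with the prescribed sources exists the normaliser vanishes and the measure
  is the junk value `0`, and for `β < 0` the `ENNReal.ofReal` truncation of negative weights makes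
  it meaningless; `isProbabilityMeasure_doubleCurrentMeasure` and every probabilistic statement
  carry `0 ≤ β` (and non-degeneracy where needed).
* The switching lemma is stated for a bounded function `F` of the *sum* `n₁ + n₂` of the two
  currents (Duminil-Copin 2016, Lemma 2.2, verbatim); functions of the trace
  `(n₁ + n₂).traced = n₁.traced ∪ n₂.traced` (`Current.traced_add`) are the special case used in
  applications. The connection event is `tracedConn G x y`, expressed with `openConn` from
  `Percolation`.

## Mathlib status

Mathlib has no currents / random-current representation (searched: `Current`, `randomCurrent`,
`switching`). Anchors used verbatim: `SimpleGraph.edgeFinset`, `Sym2`, `Nat.factorial`, `tsum`,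
`Measure.sum`, `Measure.dirac`, `symmDiff` (`∆`), `Literature.Probability.Percolation.openConn`.

## References

* R. B. Griffiths, C. A. Hurst, S. Sherman, *Concavity of magnetization of an Ising ferromagnet
  in a positive external field*, J. Math. Phys. 11 (1970) 790–795.
* M. Aizenman, *Geometric analysis of φ⁴ fields and Ising models*, Comm. Math. Phys. 86 (1982), §3.
* H. Duminil-Copin, *Random currents expansion of the Ising model*, arXiv:1607.06933 (2016), §2,
  eq. (2.2) and Lemma 2.2 (switching lemma).
-/

noncomputable section

open MeasureTheory Finset
open scoped symmDiff

namespace Literature.Probability.LatticeModels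

variable {V : Type*} [Fintype V] (G : SimpleGraph V) [DecidableRel G.Adj]

/-! ### Currents, sources and weights -/

/-- A *current* on the finite graph `G`: a function `n : E(G) → ℕ` assigning a non-negative
integer to every edge (Duminil-Copin 2016, §2.1). [cite: DuminilCopin2016, §2.1] -/
abbrev Current : Type _ := G.edgeFinset → ℕ

namespace Current

variable {G}

/-- The `n`-degree of a vertex `x`: `∑_{e ∋ x} n_e` (Duminil-Copin 2016, §2.1). [cite: DuminilCopin2016, §2.1] -/
def degree [DecidableEq V] (n : Current G) (x : V) : ℕ :=
  ∑ e : G.edgeFinset, if x ∈ (↑e : Sym2 V) then n e else 0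

/-- The set of *sources* `∂n = {x | ∑_{e ∋ x} n_e is odd}` of a current
(Duminil-Copin 2016, §2.1). [cite: DuminilCopin2016, §2.1] -/
def sources [DecidableEq V] (n : Current G) : Finset V :=
  univ.filter fun x => Odd (n.degree x)

/-- Membership in the source set: `x ∈ ∂n ↔ deg_n x` is odd (Duminil-Copin 2016, §2.1). [cite: DuminilCopin2016, §2.1] -/
@[simp] theorem mem_sources_iff [DecidableEq V] (n : Current G) (x : V) :
    x ∈ n.sources ↔ Odd (n.degree x) := by
  simp [sources]

/-- A current is sourceless iff all its degrees are even: `∂n = ∅ ↔ ∀ x, deg_n x` even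
(Duminil-Copin 2016, §2.1). [cite: DuminilCopin2016, §2.1] -/
theorem sources_empty_iff [DecidableEq V] (n : Current G) :
    n.sources = ∅ ↔ ∀ x, Even (n.degree x) := by
  simp [sources, filter_eq_empty_iff, Nat.not_odd_iff_even]

/-- The zero current has no sources (Duminil-Copin 2016, §2.1). [cite: DuminilCopin2016, §2.1] -/
@[simp] theorem sources_zero [DecidableEq V] : (0 : Current G).sources = ∅ := by
  simp [sources_empty_iff, degree]

/-- The weight `w_β(n) = ∏_e β^{n_e} / n_e!` of a current at inverse temperature `β`
(Duminil-Copin 2016, §2.1, eq. (2.1)). [cite: DuminilCopin2016, §2.1  eq. (2.1] -/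
def weight (β : ℝ) (n : Current G) : ℝ :=
  ∏ e, β ^ (n e) / ((n e).factorial : ℝ)

/-- Weights are non-negative for `β ≥ 0` (Duminil-Copin 2016, §2.1). [cite: DuminilCopin2016, §2.1] -/
theorem weight_nonneg {β : ℝ} (hβ : 0 ≤ β) (n : Current G) : 0 ≤ n.weight β :=
  prod_nonneg fun _ _ => div_nonneg (pow_nonneg hβ _) (Nat.cast_nonneg _)

/-- The zero current has weight `1` (Duminil-Copin 2016, §2.1). [cite: DuminilCopin2016, §2.1] -/
@[simp] theorem weight_zero (β : ℝ) : (0 : Current G).weight β = 1 := by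
  simp [weight]

/-- The *trace* of a current: the bond configuration `{e | n_e > 0}` of edges carrying a positive
current (Aizenman 1982, §3; Duminil-Copin 2016, §2.2). Edges not in `G` are closed. [cite: Aizenman1982, §3] -/
def traced (n : Current G) : Percolation.BondConfig V :=
  {e | ∃ h : e ∈ G.edgeFinset, 0 < n ⟨e, h⟩}

/-- Membership in the trace for an edge of `G` (Duminil-Copin 2016, §2.2). [cite: DuminilCopin2016, §2.2] -/
@[simp] theorem mem_traced_iff (n : Current G) (e : G.edgeFinset) :
    (e : Sym2 V) ∈ n.traced ↔ 0 < n e := by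
  rcases e with ⟨e, he⟩
  simp only [traced, Set.mem_setOf_eq]
  exact ⟨fun ⟨_, h⟩ => h, fun h => ⟨he, h⟩⟩

/-- The trace of a sum of currents is the union of the traces:
`traced (n₁ + n₂) = traced n₁ ∪ traced n₂` (Duminil-Copin 2016, §2.2). [cite: DuminilCopin2016, §2.2] -/
theorem traced_add (n₁ n₂ : Current G) : (n₁ + n₂).traced = n₁.traced ∪ n₂.traced := by
  ext e
  simp only [traced, Set.mem_setOf_eq, Pi.add_apply, Set.mem_union]
  constructor
  · rintro ⟨h, hpos⟩
    rcases Nat.eq_zero_or_pos (n₁ ⟨e, h⟩) with h₁ | h₁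
    · exact Or.inr ⟨h, by omega⟩
    · exact Or.inl ⟨h, h₁⟩
  · rintro (⟨h, hpos⟩ | ⟨h, hpos⟩) <;> exact ⟨h, by omega⟩

/-- The sources of a sum of currents: `∂(n₁ + n₂) = ∂n₁ ∆ ∂n₂`
(Duminil-Copin 2016, §2.2). [cite: DuminilCopin2016, §2.2] -/
theorem sources_add [DecidableEq V] (n₁ n₂ : Current G) :
    (n₁ + n₂).sources = n₁.sources ∆ n₂.sources := by
  ext x
  have hdeg : (n₁ + n₂).degree x = n₁.degree x + n₂.degree x := by
    simp only [degree, Pi.add_apply, ← sum_add_distrib]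
    exact sum_congr rfl fun e _ => by split_ifs <;> simp
  simp only [mem_sources_iff, hdeg, Nat.odd_add, mem_symmDiff]
  rw [← Nat.not_odd_iff_even]
  tauto

end Current

/-! ### The connection event of a pair of currents -/

/-- The event "`x` is connected to `y` in the trace of `n₁ + n₂`", `{x ⟷ y in n₁ + n₂}`, as a
set of pairs of currents; the hook for infinite-volume statements
(Aizenman 1982, §3; Duminil-Copin 2016, §2.2). [cite: Aizenman1982, §3] -/
def tracedConn (x y : V) : Set (Current G × Current G) :=
  {p | (p.1 + p.2).traced ∈ Percolation.openConn x y}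

/-- Membership in `tracedConn`: `x` and `y` are joined by a path of edges carrying positive
total current (Duminil-Copin 2016, §2.2). [cite: DuminilCopin2016, §2.2] -/
theorem mem_tracedConn_iff (x y : V) (p : Current G × Current G) :
    p ∈ tracedConn G x y ↔ (Percolation.openGraph (p.1 + p.2).traced).Reachable x y :=
  Iff.rfl

/-- Every vertex is connected to itself (Duminil-Copin 2016, §2.2). [cite: DuminilCopin2016, §2.2] -/
@[simp] theorem mem_tracedConn_self (x : V) (p : Current G × Current G) :
    p ∈ tracedConn G x x :=
  SimpleGraph.Reachable.refl x

/-- The connection event is measurable (every subset of the countable type of pairs of currents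
is) (Duminil-Copin 2016, §2.2). [cite: DuminilCopin2016, §2.2] -/
theorem measurableSet_tracedConn (x y : V) : MeasurableSet (tracedConn G x y) :=
  (Set.to_countable _).measurableSet

/-! ### Sums over currents and the random-current representation -/

section CurrentSum

variable [DecidableEq V]

/-- The generating sum of currents with prescribed sources,
`currentSum G β A = ∑_{n : ∂n = A} w_β(n)`, written as a `tsum` over all currents of the
indicator-weighted weight (Duminil-Copin 2016, §2.1, eq. (2.2)). [cite: DuminilCopin2016, §2.1  eq. (2.2] -/
def currentSum (β : ℝ) (A : Finset V) : ℝ :=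
  ∑' n : Current G, if n.sources = A then n.weight β else 0

/-- The current weights are summable over the (countably infinite) set of currents:
`∑_n |w_β(n)| = ∏_e exp |β| < ∞` (Duminil-Copin 2016, §2.1). [cite: DuminilCopin2016, §2.1] -/
def summable_currentWeight : Prop :=
  ∀ (β : ℝ),
    Summable fun n : Current G => n.weight β

/-- The indicator-restricted weights defining `currentSum` are summable
(Duminil-Copin 2016, §2.1). [cite: DuminilCopin2016, §2.1] -/
def summable_currentWeight_indicator : Prop :=
  ∀ (β : ℝ) (A : Finset V),
    Summable fun n : Current G => if n.sources = A then n.weight β else 0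

/-- `currentSum G β A ≥ 0` for `β ≥ 0` (Duminil-Copin 2016, §2.1). [cite: DuminilCopin2016, §2.1] -/
theorem currentSum_nonneg {β : ℝ} (hβ : 0 ≤ β) (A : Finset V) : 0 ≤ currentSum G β A :=
  tsum_nonneg fun n => by
    split_ifs
    · exact Current.weight_nonneg hβ n
    · exact le_rfl

/-- The sourceless sum is positive for `β ≥ 0`: it contains the zero current, of weight `1`
(Duminil-Copin 2016, §2.1). [cite: DuminilCopin2016, §2.1] -/
def currentSum_empty_pos : Prop :=
  ∀ {β : ℝ} (hβ : 0 ≤ β),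
    0 < currentSum G β ∅

/- interim proof relied on results that are now named facts (D-0014); demoted to a fact by the M5 import, proof preserved:
:= by
  refine (summable_currentWeight_indicator G β ∅).tsum_pos (fun n => ?_) 0 (by simp)
  split_ifs
  · exact Current.weight_nonneg hβ n
  · exact le_rfl
-/

/-- **Random-current expansion of the partition function.** For the free-boundary, zero-field
Ising model on the finite graph `G`,
`Z^∅_{G;β,0} = 2^{|V|} ∑_{∂n = ∅} w_β(n)`
(Griffiths–Hurst–Sherman 1970; Duminil-Copin 2016, §2.1, derivation of eq. (2.2)). [cite: GriffithsHurstSherman1970] -/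
def isingPartitionFunction_free_eq : Prop :=
  ∀ (β : ℝ),
    isingPartitionFunction G univ β 0 .free = 2 ^ Fintype.card V * currentSum G β ∅

/-- **Random-current representation of correlations.** For the free-boundary, zero-field Ising
model on the finite graph `G` and every `A ⊆ V`,
`⟨σ_A⟩^∅_{G;β,0} = (∑_{∂n = A} w_β(n)) / (∑_{∂n = ∅} w_β(n))`
(Griffiths–Hurst–Sherman 1970; Duminil-Copin 2016, §2.1, eq. (2.2)). [cite: GriffithsHurstSherman1970] -/
def isingCorr_free_eq_currentSum_div : Prop :=
  ∀ (β : ℝ) (A : Finset V),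
    isingCorr G univ β 0 .free A = currentSum G β A / currentSum G β ∅

/-- **Random-current representation of the two-point function.**
`⟨σ_x σ_y⟩^∅_{G;β,0} = (∑_{∂n = {x} ∆ {y}} w_β(n)) / (∑_{∂n = ∅} w_β(n))`; the symmetric
difference makes the statement correct also on the diagonal `x = y`, where both sides are `1`
(Duminil-Copin 2016, §2.1, eq. (2.2)). [cite: DuminilCopin2016, §2.1  eq. (2.2] -/
def isingTwoPoint_free_eq_currentSum_div : Prop :=
  ∀ (β : ℝ) (x y : V),
    isingTwoPoint G univ β 0 .free x y = currentSum G β ({x} ∆ {y}) / currentSum G β ∅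

end CurrentSum

/-! ### Pairs of currents: the double-current measure and the switching lemma -/

section DoubleCurrent

variable [DecidableEq V]

/-- The weight of a pair of currents restricted to prescribed sources:
`1{∂n₁ = A} 1{∂n₂ = B} w_β(n₁) w_β(n₂)` (Duminil-Copin 2016, §2.2). [cite: DuminilCopin2016, §2.2] -/
def pairWeight (β : ℝ) (A B : Finset V) (p : Current G × Current G) : ℝ :=
  if p.1.sources = A ∧ p.2.sources = B then p.1.weight β * p.2.weight β else 0

/-- Pair weights are non-negative for `β ≥ 0` (Duminil-Copin 2016, §2.2). [cite: DuminilCopin2016, §2.2] -/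
theorem pairWeight_nonneg {β : ℝ} (hβ : 0 ≤ β) (A B : Finset V) (p : Current G × Current G) :
    0 ≤ pairWeight G β A B p := by
  unfold pairWeight
  split_ifs
  · exact mul_nonneg (Current.weight_nonneg hβ _) (Current.weight_nonneg hβ _)
  · exact le_rfl

/-- The pair weights sum to `currentSum G β A * currentSum G β B`
(Duminil-Copin 2016, §2.2). [cite: DuminilCopin2016, §2.2] -/
def hasSum_pairWeight : Prop :=
  ∀ (β : ℝ) (A B : Finset V),
    HasSum (pairWeight G β A B) (currentSum G β A * currentSum G β B)

/-- The *double-current measure* with sources `A`, `B`: the probability measure on pairs of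
currents `(n₁, n₂)` proportional to `1{∂n₁ = A} 1{∂n₂ = B} w_β(n₁) w_β(n₂)`, i.e. the product
of the two normalised single-current measures `P^A ⊗ P^B`. It is written as an explicit
normalised sum of Dirac masses (the weights `βⁿ/n!` are not exponentials of a real function at
`β = 0`, so `Measure.tilted` is not used). Junk values: (i) if `currentSum G β A * currentSum G
β B = 0` (no current with the prescribed sources exists) the measure is `0`; (ii) for `β < 0`
some pair weights are negative and `ENNReal.ofReal` truncates them to `0`, so the measure is
*not* the signed normalised pair weight — every probabilistic statement about it carries the
hypothesis `0 ≤ β` (Aizenman 1982, §3; Duminil-Copin 2016, §2.2). [cite: Aizenman1982, §3] -/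
def doubleCurrentMeasure (β : ℝ) (A B : Finset V) : Measure (Current G × Current G) :=
  Measure.sum fun p : Current G × Current G =>
    ENNReal.ofReal (pairWeight G β A B p / (currentSum G β A * currentSum G β B)) •
      Measure.dirac p

/-- The double-current measure is a probability measure as soon as `β ≥ 0` and currents with
the prescribed sources exist (Duminil-Copin 2016, §2.2). [cite: DuminilCopin2016, §2.2] -/
def isProbabilityMeasure_doubleCurrentMeasure : Prop :=
  ∀ {β : ℝ} (hβ : 0 ≤ β) {A B : Finset V} (hA : currentSum G β A ≠ 0) (hB : currentSum G β B ≠ 0),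
    IsProbabilityMeasure (doubleCurrentMeasure G β A B)

/-- **Switching lemma** (two-source form). For every `A ⊆ V`, all vertices `x, y` and every
bounded `F` on currents,
`∑_{∂n₁ = A, ∂n₂ = {x} ∆ {y}} F(n₁ + n₂) w_β(n₁) w_β(n₂)
  = ∑_{∂n₁ = A ∆ {x} ∆ {y}, ∂n₂ = ∅} F(n₁ + n₂) w_β(n₁) w_β(n₂) 1{x ⟷ y in n₁ + n₂}`
(Griffiths–Hurst–Sherman 1970; Aizenman 1982, Lemma 3.2; Duminil-Copin 2016, Lemma 2.2). The
boundedness of `F` guarantees absolute convergence of both series on the (infinite) set of pairs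
of currents of the finite graph `G`. [cite: GriffithsHurstSherman1970] -/
def currentSum_switching : Prop :=
  ∀ (β : ℝ) (A : Finset V) (x y : V) (F : Current G → ℝ) (hF : ∃ C, ∀ n, ‖F n‖ ≤ C),
    ∑' p : Current G × Current G, pairWeight G β A ({x} ∆ {y}) p * F (p.1 + p.2) =
      ∑' p : Current G × Current G,
        pairWeight G β (A ∆ ({x} ∆ {y})) ∅ p * F (p.1 + p.2) *
          (tracedConn G x y).indicator 1 p

/-- Probabilistic form of the switching lemma with `F = 1`, for `β ≥ 0`:
`currentSum A · currentSum ({x} ∆ {y}) = currentSum (A ∆ {x} ∆ {y}) · currentSum ∅ ·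
P^{A ∆ {x} ∆ {y}} ⊗ P^∅ [x ⟷ y in n₁ + n₂]`. The hypothesis `0 ≤ β` is needed because
`doubleCurrentMeasure` truncates negative pair weights; the signed identity valid for every real
`β` is `currentSum_switching` with `F = 1`. No non-degeneracy hypothesis is needed: if
`currentSum (A ∆ {x} ∆ {y}) = 0` both sides vanish
(Aizenman 1982, §3; Duminil-Copin 2016, Lemma 2.2 and its corollaries in §2.3). [cite: Aizenman1982, §3] -/
def currentSum_mul_currentSum_pair : Prop :=
  ∀ {β : ℝ} (hβ : 0 ≤ β) (A : Finset V) (x y : V),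
    currentSum G β A * currentSum G β ({x} ∆ {y}) =
      currentSum G β (A ∆ ({x} ∆ {y})) * currentSum G β ∅ *
        (doubleCurrentMeasure G β (A ∆ ({x} ∆ {y})) ∅).real (tracedConn G x y)

/-- The squared two-point function as a sourceless double-current connection probability
(switching with `A = {x} ∆ {y}`): `⟨σ_x σ_y⟩^∅_{G;β,0}² = P^∅ ⊗ P^∅ [x ⟷ y in n₁ + n₂]` for
`β ≥ 0` (Aizenman 1982, Prop. 3.1; Duminil-Copin 2016, Corollary 2.3). [cite: Aizenman1982, Prop. 3.1] -/
def isingTwoPoint_free_sq_eq : Prop :=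
  ∀ {β : ℝ} (hβ : 0 ≤ β) (x y : V),
    isingTwoPoint G univ β 0 .free x y ^ 2 =
      (doubleCurrentMeasure G β ∅ ∅).real (tracedConn G x y)

end DoubleCurrent

end Literature.Probability.LatticeModels
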